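import Summits.HodgeConjecture.HodgeConjecture.Theorems.CyclicUnitaryPowersCyclicCoverIrreducible
import Literature.AlgebraicGeometry.HodgeTheory.DiagonalSymmetryEigenHodgeNumbers

/-!
# The Jacobian ideal of the cyclic cover form `x₃^p − f` under the covering group:
# eigen-parts of numerators (route `CyclicUnitaryPowers`, item stmt-HodgeConjecture-19544; helper)

Helper file for crux K1 `VeryGeneralDeckCommutatorsInHg` of route
`route-HodgeConjecture-CyclicUnitaryPowers` (cell `hodge-nonav`), landed
`--supports stmt-HodgeConjecture-19544`. Prover seat `hodge-nonav-prover-Bx` (g5), 2026-08-27.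
Sorry-free, no definition, no named fact. Consumed by `CyclicUnitaryPowersJacobianEigenpartsCount`
and `CyclicUnitaryPowersDeckHodgeOfGriffiths` (the two Carlson–Toledo Hodge-number facts of K1 —
`carlsonToledo1999_finrank_eigenspace_deck_one` and `…_inf_hodgePiece` — from Griffiths' residue
theorem).

This is the commutative algebra of Carlson–Toledo 1999 §5 for the models
`F = x₃^p − f(x₀,x₁,x₂)` (`cyclicCoverForm p f`) under the deck unit `a = (1,1,1,ζ)`, `ζ = e^{2πi/p}`
(`deckUnit p`), whose twisted action on numerator polynomials is
`T_a x^e = ζ^{e₃+1} x^e` (`diagonalCharacter_deckUnit`; Carlson–Toledo: "the rational differential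
`y^{i−1}A(x)Ω(x,y)/(y^k + P(x))^{q+1}` has eigenvalue `μ = ζ^i`"):

* §1 `ℂ[x₀,…,x₃] = ℂ[x₀,x₁,x₂][x₃]`: the coefficient of `x₃^m` (`Ψ P = optionEquivLeft (rename
  finSuccEquivLast P)`, the bookkeeping of `CyclicUnitaryPowersCyclicCoverIrreducible`), its value on
  monomials / products (`coeff_psi_coeff`, `coeff_psi_mul_rename_castSucc`, …), degrees.
* §2 the character `χ_a(e) = ζ^{e₃+1}`; a `ζ^i`-eigen-monomial (`i < p`) has `e₃ = i − 1` or
  `e₃ ≥ p − 1` (`le_last_of_diagonalCharacter_eq`, primitivity of `ζ`).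
* §3 the Jacobian ideal `J_F = (∂₀f, ∂₁f, ∂₂f, p·x₃^{p−1})`: `∂F/∂x₃ = p x₃^{p−1}`,
  `∂F/∂xⱼ = −∂f/∂xⱼ`; monomials with `e₃ ≥ p − 1` lie in `J_F`; `J_f ⊂ J_F`; conversely the
  `x₃^m`-coefficient of an element of `J_F` lies in `J_f` for `m ≤ p − 2`
  (`coeff_psi_mem_jacobianIdeal`); and **every `T_a`-invariant numerator lies in `J_F`**
  (`mem_jacobianIdeal_of_mem_eigenspace_one`: invariance forces `p ∣ e₃ + 1`), the hypothesis of the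
  invariant-line theorem `eigenspace_one_eq_hyperplaneClasses_of_residueKernel`.
* §4 the section `A ↦ A·x₃^m` of the coefficient map is `T_a`-equivariant of weight `ζ^{m+1}`.

## References

* [CarlsonToledo1999] J. A. Carlson, D. Toledo, Discriminant complements and kernels of monodromy
  representations, Duke Math. J. 97 (1999); arXiv alg-geom/9708002, §5 (held text p0011–p0012).
* [VoisinHodgeII2003] C. Voisin, Hodge Theory and Complex Algebraic Geometry II, CUP 2003, §6.1.3
  Def. 6.9, Cor. 6.12.
-/

noncomputable section

-- mandated namespace `Summit.HodgeConjecture.HodgeConjecture.Theorems` trips `linter.dupNamespace` (off tree-wide)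
set_option linter.dupNamespace false

namespace Summit.HodgeConjecture.HodgeConjecture.Theorems.CyclicUnitaryPowersJacobianEigenparts

open scoped Polynomial
open Literature.AlgebraicGeometry.Motives Literature.AlgebraicGeometry.HodgeTheory
open Literature.RingTheory.MvPolynomial (idealDegree mem_idealDegree)
open Summit.HodgeConjecture.HodgeConjecture.Theorems.CyclicUnitaryPowersCyclicCoverIrreducible
  (psi_X_last psi_X_castSucc psi_C psi_rename_castSucc last_notMem_vars_rename_castSucc)
open MvPolynomial

variable {p : ℕ} {f : MvPolynomial (Fin 3) ℂ}

/-! ### §1 The coefficient of `x₃^m`: `Ψ P = optionEquivLeft (rename finSuccEquivLast P) ∈ ℂ[x₀,x₁,x₂][x₃]` -/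

/-- **Coefficients of the `x₃^m`-coefficient**: the coefficient of `x^d` (`d ∈ ℕ³`) in the
`x₃^m`-coefficient of `P` is the coefficient of `x^{(d, m)}` in `P`. [folklore] -/
theorem coeff_psi_coeff (P : MvPolynomial (Fin 4) ℂ) (m : ℕ) (d : Fin 3 →₀ ℕ) :
    coeff d ((MvPolynomial.optionEquivLeft ℂ (Fin 3) (rename finSuccEquivLast P)).coeff m) =
      coeff (Finsupp.equivFunOnFinite.symm (Fin.snoc (⇑d) m : Fin 4 → ℕ)) P := by
  rw [optionEquivLeft_coeff_coeff]
  have h : d.optionElim m = Finsupp.mapDomain finSuccEquivLast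
      (Finsupp.equivFunOnFinite.symm (Fin.snoc (⇑d) m : Fin 4 → ℕ)) := by
    ext o
    rw [Finsupp.mapDomain_equiv_apply, Finsupp.coe_equivFunOnFinite_symm]
    cases o with
    | none => rw [Finsupp.optionElim_apply_none, finSuccEquivLast_symm_none, Fin.snoc_last]
    | some j => rw [Finsupp.optionElim_apply_some, finSuccEquivLast_symm_some, Fin.snoc_castSucc]
  rw [h, coeff_rename_mapDomain _ finSuccEquivLast.injective]

/-- An exponent `e ∈ ℕ⁴` is `(init e, e₃)`. [folklore] -/
theorem equivFunOnFinite_symm_snoc_init (e : Fin 4 →₀ ℕ) :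
    Finsupp.equivFunOnFinite.symm
        (Fin.snoc (⇑(Finsupp.equivFunOnFinite.symm (Fin.init ⇑e : Fin 3 → ℕ))) (e (Fin.last 3)) :
          Fin 4 → ℕ) = e := by
  ext j
  rw [Finsupp.coe_equivFunOnFinite_symm, Finsupp.coe_equivFunOnFinite_symm, Fin.snoc_init_self]

/-- **Every coefficient of `P` is a coefficient of some `x₃^m`-coefficient**:
`P_e = (Ψ P)_{e₃, init e}`. [folklore] -/
theorem coeff_eq_coeff_psi_coeff (P : MvPolynomial (Fin 4) ℂ) (e : Fin 4 →₀ ℕ) :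
    coeff e P = coeff (Finsupp.equivFunOnFinite.symm (Fin.init ⇑e : Fin 3 → ℕ))
      ((MvPolynomial.optionEquivLeft ℂ (Fin 3) (rename finSuccEquivLast P)).coeff (e (Fin.last 3))) := by
  rw [coeff_psi_coeff, equivFunOnFinite_symm_snoc_init]

/-- Degrees: `|(d, m)| = |d| + m`. [folklore] -/
theorem degree_equivFunOnFinite_symm_snoc (d : Fin 3 →₀ ℕ) (m : ℕ) :
    (Finsupp.equivFunOnFinite.symm (Fin.snoc (⇑d) m : Fin 4 → ℕ)).degree = d.degree + m := by
  rw [Finsupp.degree_eq_sum, Finsupp.degree_eq_sum, Fin.sum_univ_castSucc]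
  simp only [Finsupp.coe_equivFunOnFinite_symm, Fin.snoc_castSucc, Fin.snoc_last]

/-- Degrees: `|e| = |init e| + e₃`. [folklore] -/
theorem degree_eq_degree_init_add (e : Fin 4 →₀ ℕ) :
    e.degree = (Finsupp.equivFunOnFinite.symm (Fin.init ⇑e : Fin 3 → ℕ)).degree + e (Fin.last 3) := by
  conv_lhs => rw [← equivFunOnFinite_symm_snoc_init e]
  rw [degree_equivFunOnFinite_symm_snoc]

/-- **`Ψ (Q · g(x₀,x₁,x₂)) = Ψ Q · g` on coefficients**: `(Q·g)_{[m]} = Q_{[m]} · g`. [folklore] -/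
theorem coeff_psi_mul_rename_castSucc (Q : MvPolynomial (Fin 4) ℂ) (g : MvPolynomial (Fin 3) ℂ) (m : ℕ) :
    (MvPolynomial.optionEquivLeft ℂ (Fin 3) (rename finSuccEquivLast (Q * rename Fin.castSucc g))).coeff m =
      (MvPolynomial.optionEquivLeft ℂ (Fin 3) (rename finSuccEquivLast Q)).coeff m * g := by
  rw [map_mul, map_mul, psi_rename_castSucc, Polynomial.coeff_mul_C]

/-- **`(Q · x₃^j)_{[m]} = Q_{[m−j]}`** (`0` for `m < j`). [folklore] -/
theorem coeff_psi_mul_X_last_pow (Q : MvPolynomial (Fin 4) ℂ) (j m : ℕ) :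
    (MvPolynomial.optionEquivLeft ℂ (Fin 3) (rename finSuccEquivLast (Q * X (Fin.last 3) ^ j))).coeff m =
      if j ≤ m then (MvPolynomial.optionEquivLeft ℂ (Fin 3) (rename finSuccEquivLast Q)).coeff (m - j)
      else 0 := by
  rw [map_mul, map_mul, map_pow, map_pow, psi_X_last, Polynomial.coeff_mul_X_pow']

/-- **`(A(x₀,x₁,x₂) · x₃^j)_{[m]} = A`** for `m = j`, `0` otherwise. [folklore] -/
theorem coeff_psi_rename_castSucc_mul_X_last_pow (A : MvPolynomial (Fin 3) ℂ) (j m : ℕ) :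
    (MvPolynomial.optionEquivLeft ℂ (Fin 3)
        (rename finSuccEquivLast (rename Fin.castSucc A * X (Fin.last 3) ^ j))).coeff m =
      if m = j then A else 0 := by
  rw [map_mul, map_mul, map_pow, map_pow, psi_rename_castSucc, psi_X_last, Polynomial.coeff_C_mul_X_pow]

/-- The coefficients of `A · x₃^j`: `(A x₃^j)_e = A_{init e}` if `e₃ = j`, else `0`. [folklore] -/
theorem coeff_rename_castSucc_mul_X_last_pow (A : MvPolynomial (Fin 3) ℂ) (j : ℕ) (e : Fin 4 →₀ ℕ) :
    coeff e (rename Fin.castSucc A * X (Fin.last 3) ^ j) =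
      if e (Fin.last 3) = j then coeff (Finsupp.equivFunOnFinite.symm (Fin.init ⇑e : Fin 3 → ℕ)) A
      else 0 := by
  rw [coeff_eq_coeff_psi_coeff, coeff_psi_rename_castSucc_mul_X_last_pow]
  split_ifs
  · rfl
  · exact coeff_zero _

/-- **The `x₃^m`-coefficient of a form of degree `k` is a form of degree `k − m`.** [folklore] -/
theorem isHomogeneous_coeff_psi {P : MvPolynomial (Fin 4) ℂ} {k : ℕ} (hP : P.IsHomogeneous k) (m : ℕ) :
    ((MvPolynomial.optionEquivLeft ℂ (Fin 3) (rename finSuccEquivLast P)).coeff m).IsHomogeneous (k - m) := by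
  intro d hd
  rw [coeff_psi_coeff] at hd
  have h : (Finsupp.equivFunOnFinite.symm (Fin.snoc (⇑d) m : Fin 4 → ℕ)).degree = k := by
    by_contra hne
    exact hd (hP.coeff_eq_zero hne)
  rw [degree_equivFunOnFinite_symm_snoc] at h
  have h' : d.degree = k - m := by omega
  rw [Finsupp.degree_eq_weight_one] at h'
  exact h'

/-! ### §2 The character of the deck unit: `T_a x^e = ζ^{e₃+1} x^e` -/

/-- The deck unit is `ζ = e^{2πi/p}` in the last coordinate. [folklore] -/
theorem val_deckUnit_last (p : ℕ) :
    ((deckUnit p (Fin.last 3) : ℂˣ) : ℂ) = Complex.exp (2 * (Real.pi : ℂ) * Complex.I / (p : ℂ)) := by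
  simp [deckUnit]

/-- The deck unit is `1` in the first three coordinates. [folklore] -/
theorem val_deckUnit_castSucc (p : ℕ) (j : Fin 3) : ((deckUnit p (Fin.castSucc j) : ℂˣ) : ℂ) = 1 := by
  have h : Fin.castSucc j ≠ Fin.last 3 := (Fin.castSucc_lt_last j).ne
  unfold deckUnit
  rw [if_neg h, Units.val_one]

/-- **The character of the deck unit on monomial residues**: `χ_a(e) = ζ^{e₃ + 1}` ("the rational
differential `y^{i−1}A(x)Ω/(y^k+P)^{q+1}` has eigenvalue `ζ^i`": numerator `x₃`-degree `i − 1`).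
[cite: CarlsonToledo1999, §5 (held text p0011)] -/
theorem diagonalCharacter_deckUnit (p : ℕ) (e : Fin 4 →₀ ℕ) :
    diagonalCharacter (deckUnit p) e =
      Complex.exp (2 * (Real.pi : ℂ) * Complex.I / (p : ℂ)) ^ (e (Fin.last 3) + 1) := by
  rw [diagonalCharacter_apply, Fin.prod_univ_castSucc]
  simp only [val_deckUnit_castSucc, one_pow, Finset.prod_const_one, one_mul]
  have h3 : ((deckUnit p (Fin.last (2 + 1)) : ℂˣ) : ℂ) = Complex.exp (2 * (Real.pi : ℂ) * Complex.I / (p : ℂ)) :=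
    val_deckUnit_last p
  rw [h3]

/-- **A `ζ^i`-eigen-monomial (`i < p`) has `x₃`-degree `i − 1` or at least `p − 1`**: if
`χ_a(e) = ζ^i` and `e₃ + 1 ≠ i` then `e₃ ≥ p − 1` (`ζ` is a PRIMITIVE `p`-th root of unity).
[cite: CarlsonToledo1999, §5 (held text p0011)] -/
theorem le_last_of_diagonalCharacter_eq (hp : 2 ≤ p) {i : ℕ} (hi : i < p) {e : Fin 4 →₀ ℕ}
    (he : diagonalCharacter (deckUnit p) e = Complex.exp (2 * (Real.pi : ℂ) * Complex.I / (p : ℂ)) ^ i)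
    (hne : e (Fin.last 3) + 1 ≠ i) : p - 1 ≤ e (Fin.last 3) := by
  rw [diagonalCharacter_deckUnit] at he
  by_contra hlt
  have hlt' : e (Fin.last 3) + 1 < p := by omega
  exact hne ((Complex.isPrimitiveRoot_exp p (by omega)).pow_inj hlt' hi he)

/-! ### §3 The Jacobian ideal `J_F = (∂₀f, ∂₁f, ∂₂f, p·x₃^{p−1})` -/

/-- `∂F/∂x₃ = p · x₃^{p−1}`. [cite: CarlsonToledo1999, §5 (held text p0011)] -/
theorem pderiv_last_cyclicCoverForm (p : ℕ) (f : MvPolynomial (Fin 3) ℂ) :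
    pderiv (Fin.last 3) (cyclicCoverForm p f) = C (p : ℂ) * X (Fin.last 3) ^ (p - 1) := by
  rw [cyclicCoverForm_def, map_sub, pderiv_eq_zero_of_notMem_vars (last_notMem_vars_rename_castSucc f),
    sub_zero, X_pow_eq_monomial, pderiv_monomial, Finsupp.single_eq_same, one_mul,
    C_mul_X_pow_eq_monomial, ← Finsupp.single_tsub]

/-- `∂F/∂xⱼ = −∂f/∂xⱼ` for `j < 3`. [cite: CarlsonToledo1999, §5 (held text p0011)] -/
theorem pderiv_castSucc_cyclicCoverForm (p : ℕ) (f : MvPolynomial (Fin 3) ℂ) (j : Fin 3) :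
    pderiv (Fin.castSucc j) (cyclicCoverForm p f) = -rename Fin.castSucc (pderiv j f) := by
  rw [cyclicCoverForm_def, map_sub, pderiv_rename (Fin.castSucc_injective 3), (pderiv _).leibniz_pow,
    pderiv_X_of_ne (Fin.castSucc_lt_last j).ne', smul_zero, smul_zero, zero_sub]

/-- **`x₃^{p−1} ∈ J_F`** (`= p⁻¹ ∂F/∂x₃`). [cite: CarlsonToledo1999, §5 (held text p0011)] -/
theorem X_last_pow_mem_jacobianIdeal (hp : p ≠ 0) (f : MvPolynomial (Fin 3) ℂ) :
    X (Fin.last 3) ^ (p - 1) ∈ UniversalHypersurface.jacobianIdeal (cyclicCoverForm p f) := by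
  have h := UniversalHypersurface.pderiv_mem_jacobianIdeal (cyclicCoverForm p f) (Fin.last 3)
  rw [pderiv_last_cyclicCoverForm] at h
  have h' : (X (Fin.last 3) ^ (p - 1) : MvPolynomial (Fin 4) ℂ) =
      C ((p : ℂ)⁻¹) * (C (p : ℂ) * X (Fin.last 3) ^ (p - 1)) := by
    rw [← mul_assoc, ← C_mul, inv_mul_cancel₀ (Nat.cast_ne_zero.mpr hp), C_1, one_mul]
  rw [h']
  exact Ideal.mul_mem_left _ _ h

/-- **Monomials with `e₃ ≥ p − 1` lie in `J_F`.** [cite: CarlsonToledo1999, §5 (held text p0011)] -/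
theorem monomial_mem_jacobianIdeal_of_le (hp : p ≠ 0) (f : MvPolynomial (Fin 3) ℂ) {e : Fin 4 →₀ ℕ}
    (he : p - 1 ≤ e (Fin.last 3)) (c : ℂ) :
    monomial e c ∈ UniversalHypersurface.jacobianIdeal (cyclicCoverForm p f) := by
  have hsplit : e = (e - Finsupp.single (Fin.last 3) (p - 1)) + Finsupp.single (Fin.last 3) (p - 1) :=
    (tsub_add_cancel_of_le (Finsupp.single_le_iff.mpr he)).symm
  rw [hsplit, monomial_add_single]
  exact Ideal.mul_mem_left _ _ (X_last_pow_mem_jacobianIdeal hp f)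

/-- `∂f/∂xⱼ`, pulled back to `ℂ[x₀,…,x₃]`, lies in `J_F`. [cite: CarlsonToledo1999, §5 (held text p0011)] -/
theorem rename_castSucc_pderiv_mem_jacobianIdeal (p : ℕ) (f : MvPolynomial (Fin 3) ℂ) (j : Fin 3) :
    rename Fin.castSucc (pderiv j f) ∈ UniversalHypersurface.jacobianIdeal (cyclicCoverForm p f) := by
  have h := UniversalHypersurface.pderiv_mem_jacobianIdeal (cyclicCoverForm p f) (Fin.castSucc j)
  rw [pderiv_castSucc_cyclicCoverForm] at h
  exact neg_mem_iff.mp h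

/-- **`J_f ⊂ J_F`**: the Jacobian ideal of the branch form, pulled back, lies in the Jacobian ideal
of the cover form. [cite: CarlsonToledo1999, §5 (held text p0011)] -/
theorem rename_castSucc_mem_jacobianIdeal (p : ℕ) {A : MvPolynomial (Fin 3) ℂ}
    (hA : A ∈ UniversalHypersurface.jacobianIdeal f) :
    rename Fin.castSucc A ∈ UniversalHypersurface.jacobianIdeal (cyclicCoverForm p f) := by
  obtain ⟨c, rfl⟩ := Ideal.mem_span_range_iff_exists_fun.mp hA
  rw [map_sum]
  refine Ideal.sum_mem _ fun j _ ↦ ?_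
  rw [map_mul]
  exact Ideal.mul_mem_left _ _ (rename_castSucc_pderiv_mem_jacobianIdeal p f j)

/-- **The `x₃^m`-coefficient of an element of `J_F` lies in `J_f`, for `m ≤ p − 2`**: writing
`P = Σⱼ cⱼ ∂ⱼF = −Σ_{j<3} cⱼ ∂ⱼf + c₃ · p x₃^{p−1}`, the last term has no `x₃^m`-coefficient and
`(cⱼ ∂ⱼf)_{[m]} = (cⱼ)_{[m]} ∂ⱼf`. (Carlson–Toledo §5: "the corresponding space of numerator
polynomials, taken modulo the Jacobian ideal of `P`".) [cite: CarlsonToledo1999, §5 (held text p0011–p0012)] -/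
theorem coeff_psi_mem_jacobianIdeal {m : ℕ} (hm : m + 1 < p) {P : MvPolynomial (Fin 4) ℂ}
    (hP : P ∈ UniversalHypersurface.jacobianIdeal (cyclicCoverForm p f)) :
    (MvPolynomial.optionEquivLeft ℂ (Fin 3) (rename finSuccEquivLast P)).coeff m ∈
      UniversalHypersurface.jacobianIdeal f := by
  obtain ⟨c, rfl⟩ := Ideal.mem_span_range_iff_exists_fun.mp hP
  rw [map_sum, map_sum, Polynomial.finsetSum_coeff, Fin.sum_univ_castSucc]
  refine Ideal.add_mem _ (Ideal.sum_mem _ fun j _ ↦ ?_) ?_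
  · rw [pderiv_castSucc_cyclicCoverForm, mul_neg, map_neg, map_neg, Polynomial.coeff_neg,
      coeff_psi_mul_rename_castSucc]
    exact neg_mem_iff.mpr (Ideal.mul_mem_left _ _ (UniversalHypersurface.pderiv_mem_jacobianIdeal f j))
  · rw [pderiv_last_cyclicCoverForm, ← mul_assoc, coeff_psi_mul_X_last_pow, if_neg (by omega)]
    exact Submodule.zero_mem _

/-- **Every invariant numerator lies in the Jacobian ideal**: if `T_a P = P` (every monomial `x^e`
of `P` has `ζ^{e₃+1} = 1`, i.e. `p ∣ e₃ + 1`, so `e₃ ≥ p − 1`), then `P ∈ (x₃^{p−1}) ⊆ J_F`. This is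
the hypothesis of the invariant-line theorem `eigenspace_one_eq_hyperplaneClasses_of_residueKernel`
for the cyclic covers (Carlson–Toledo §2: the primitive cohomology has no invariants,
"`H^{n+1}(Y,ℂ)_0 = ⊕_{μ ≠ 1} H(μ)`"). [cite: CarlsonToledo1999, §2 (held text p0005) and §5 (p0011)] -/
theorem mem_jacobianIdeal_of_mem_eigenspace_one (hp : 2 ≤ p) (f : MvPolynomial (Fin 3) ℂ)
    {P : MvPolynomial (Fin 4) ℂ} (hP : P ∈ Module.End.eigenspace (twistedDiagonalAction (deckUnit p)) 1) :
    P ∈ UniversalHypersurface.jacobianIdeal (cyclicCoverForm p f) := by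
  rw [mem_eigenspace_twistedDiagonalAction_iff] at hP
  rw [as_sum P]
  refine Ideal.sum_mem _ fun e he ↦ monomial_mem_jacobianIdeal_of_le (by omega) f ?_ _
  refine le_last_of_diagonalCharacter_eq hp (i := 0) (by omega) ?_ (by omega)
  rw [pow_zero]
  exact hP e he

/-! ### §4 The section `A ↦ A · x₃^m` is `T_a`-equivariant of weight `ζ^{m+1}` -/

/-- The deck scaling fixes polynomials in `x₀, x₁, x₂`. [folklore] -/
theorem aeval_diagonalSubst_deckUnit_rename_castSucc (p : ℕ) (A : MvPolynomial (Fin 3) ℂ) :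
    aeval (diagonalSubst (deckUnit p)) (rename Fin.castSucc A) = rename Fin.castSucc A := by
  have h : (diagonalSubst (deckUnit p) ∘ Fin.castSucc : Fin 3 → MvPolynomial (Fin 4) ℂ) =
      X ∘ Fin.castSucc := by
    funext j
    rw [Function.comp_apply, Function.comp_apply, diagonalSubst_apply, val_deckUnit_castSucc, C_1, one_mul]
  rw [aeval_rename, h, rename_eq_aeval]

/-- The deck scaling multiplies `x₃` by `ζ`. [folklore] -/
theorem aeval_diagonalSubst_deckUnit_X_last (p : ℕ) :
    aeval (diagonalSubst (deckUnit p)) (X (Fin.last 3) : MvPolynomial (Fin 4) ℂ) =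
      C (Complex.exp (2 * (Real.pi : ℂ) * Complex.I / (p : ℂ))) * X (Fin.last 3) := by
  rw [aeval_X, diagonalSubst_apply, val_deckUnit_last]

/-- **`A(x₀,x₁,x₂) · x₃^m` is a `ζ^{m+1}`-eigenvector of the twisted action** (Carlson–Toledo §5:
numerator `y^{i−1}A(x)` ↦ eigenvalue `ζ^i`). [cite: CarlsonToledo1999, §5 (held text p0011)] -/
theorem rename_castSucc_mul_X_last_pow_mem_eigenspace (p : ℕ) (A : MvPolynomial (Fin 3) ℂ) (m : ℕ) :
    rename Fin.castSucc A * X (Fin.last 3) ^ m ∈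
      Module.End.eigenspace (twistedDiagonalAction (deckUnit p))
        (Complex.exp (2 * (Real.pi : ℂ) * Complex.I / (p : ℂ)) ^ (m + 1)) := by
  rw [Module.End.mem_eigenspace_iff, twistedDiagonalAction_apply, map_mul, map_pow,
    aeval_diagonalSubst_deckUnit_rename_castSucc, aeval_diagonalSubst_deckUnit_X_last, Fin.prod_univ_castSucc]
  simp only [val_deckUnit_castSucc, Finset.prod_const_one, one_mul]
  have h3 : ((deckUnit p (Fin.last (2 + 1)) : ℂˣ) : ℂ) = Complex.exp (2 * (Real.pi : ℂ) * Complex.I / (p : ℂ)) :=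
    val_deckUnit_last p
  rw [h3, smul_eq_C_mul, smul_eq_C_mul, map_pow]
  ring

/-- `A · x₃^m` is homogeneous of degree `k + m` when `A` is homogeneous of degree `k`. [folklore] -/
theorem isHomogeneous_rename_castSucc_mul_X_last_pow {A : MvPolynomial (Fin 3) ℂ} {k : ℕ}
    (hA : A.IsHomogeneous k) (m : ℕ) :
    (rename Fin.castSucc A * X (Fin.last 3) ^ m : MvPolynomial (Fin 4) ℂ).IsHomogeneous (k + m) := by
  have h := (hA.rename_isHomogeneous (f := Fin.castSucc)).mul ((isHomogeneous_X ℂ (Fin.last 3)).pow m)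
  rwa [one_mul] at h

end Summit.HodgeConjecture.HodgeConjecture.Theorems.CyclicUnitaryPowersJacobianEigenparts

end
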